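import Literature.NumberTheory.PAdicHodge.AinfRamifiedOmegaPeriodAdd
import Literature.NumberTheory.PAdicHodge.AinfWeierstrassEtaPeriod
import HarnessLib

/-!
# The η-period `∫_t η ∈ B_dR⁺(F)` of a Tate-module point of the formal group of a Weierstrass equation over the ramified
# base `𝒪_D = ℤ_p[ϖ]`, and its `Γ_F`-equivariance

Topic `Literature/NumberTheory/PAdicHodge`; the ramified twin (`𝒪 = 𝒪_D = ℤ_p[X]/(f)`, `W/𝒪_D`) of `AinfWeierstrassEtaPeriod`
(`𝒪 = ℤ_p`, `W/ℤ`), on top of `AinfRamifiedTorsionLift` (Fontaine's element `[t] ∈ A_inf(𝒪)`), `AinfRamifiedOmegaPeriod(Add)`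
(`ι_𝒪[t] ∈ Fil¹B_dR⁺`, the coefficient map `CoeffDisc.toFieldCoeff : 𝒪_D → F`) and `EllipticCurves/FormalGroupQuasiPeriodMulDefect`
(`η₀`, its multiplication defects `R_n`, integrality of `R_n`). For `W` over the discrete copy `CoeffDisc D` of `𝒪_D`, a `p`-power
compatible sequence `t = (uᵢ)` of points of `Ŵ(𝔪_{ℂ_F})` (`[p]u_{i+1} = uᵢ`, `u₀ = 0`), Colmez's second period in closed form is

  **`∫_t η = η₀(ι_𝒪T₀) − ι_𝒪(Σ_{i≥1} p^{i−1} R_p(Tᵢ))`**,   `Tᵢ := [t⁽ⁱ⁾] ∈ A_inf(𝒪)` (Fontaine's element of `(u_{n+i})ₙ`),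

with `η₀ ∈ F⟦X⟧` evaluated `ξ`-adically on `Fil¹B_dR⁺` and the correction a `(p, ω)`-adically convergent series of elements of
`A_inf(𝒪)` (`R_p ∈ 𝒪_D⟦X⟧`, `Tᵢ ∈ 𝔫 = θ_𝒪⁻¹(𝔪_{ℂ_F})`):

* §0 `𝒪_D` is a domain and `𝒪_D → F` is injective (`EisensteinRoot.isDomain_coeff`, `Coeff.toF_injective`; Eisenstein ⇒ irreducible);
* §1 `etaSeries` (`η₀` of `W ×_{𝒪_D} F` over `FieldCoeff`), `mulDefect W n ∈ 𝒪_D⟦X⟧` (an integral `R_n`, from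
  `exists_map_eq_formalQuasiPeriodMulDefect` along `𝒪_D ↪ F`);
* §2 `etaPeriodMain t = η₀(ι_𝒪T₀)` and its `Γ_F`-equivariance;
* §3 the shifted sequences: `torsionLiftShift t i = Tᵢ`, `θ_𝒪(Tᵢ) = uᵢ`, `Tᵢ ∈ 𝔫`, **`[p]T_{i+1} = Tᵢ`**, `σTᵢ = Tᵢ(σt)`;
* §4 the correction `etaCorr t = Σ_{i≥1} p^{i−1}R_p(Tᵢ) ∈ A_inf(𝒪)` (`(p, ω)`-adic limit of the partial sums) and its equivariance;
* §5 **`etaPeriod t := η₀(ι_𝒪T₀) − ι_𝒪(etaCorr t) ∈ B_dR⁺`** and **`gal_etaPeriod : σ(∫_t η) = ∫_{σt} η`**.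

Additivity in `t` and `θ_dR(∫_t η) = −Σ p^{i−1}R_p(uᵢ)` are the sequel. Definitions (reviewed): `etaSeries`, `mulDefect`, `etaPeriodMain`,
`torsionLiftShift`, `torsionLiftShiftPt`, `mulDefectAt`, `etaCorrPartial`, `etaCorr`, `etaPeriod`. No named facts, no instances, no `sorry`.
Written for the sub-unit (R1) of crux K★ `stmt-BirchSwinnertonDyer-22226` (memo `Cruxes/StarredOptimalManinUnitFiveSeven/Lines/kato-lever-hDR-R1-models-descent.md`):
the second, Fil¹-transverse de Rham period of `V_pŴ` for the good supersingular `𝒪_D`-models of the additive cells; BSD is not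
proved by any of this.

## References
* P. Colmez, *Périodes p-adiques des variétés abéliennes*, Math. Ann. 292 (1992), §2. [Colmez1992PeriodesAbeliennes]
* N. M. Katz, *Crystalline cohomology, Dieudonné modules, and Jacobi sums* (1981), §5.1. [Katz1981CrystallineDieudonne]
* J.-M. Fontaine, *Le corps des périodes p-adiques*, Astérisque 223 (1994), Exp. II §1.2, §1.5. [FontaineAsterisque223III]
* J.-P. Serre, *Local Fields* (1979), Ch. I §6. [SerreLocalFields1979]
-/

noncomputable section

open Ideal Filter Topology Field WittVector MvPowerSeries ValuativeRel Polynomial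

namespace Literature.NumberTheory.PAdicHodge

open Literature.NumberTheory.GaloisRepresentations
open Literature.NumberTheory.GaloisRepresentations.IsNonarchimedeanLocalField
open Literature.NumberTheory.GaloisRepresentations.LubinTate

variable {F : Type} [Field F] [ValuativeRel F] [TopologicalSpace F] [IsNonarchimedeanLocalField F] [CharZero F]
  {p : ℕ} [Fact p.Prime] {hp : valuation F p < 1}

/-! ## §0 `𝒪_D` is a domain; `𝒪_D → F` is injective -/

namespace EisensteinRoot

variable (D : EisensteinRoot F p hp)

/-- **An Eisenstein polynomial is irreducible** (Mathlib's Eisenstein criterion over the DVR `ℤ_p`). [cite: SerreLocalFields1979, Ch. I §6 Prop. 17] -/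
theorem irreducible_poly : Irreducible D.poly :=
  D.isEisensteinAt.irreducible
    (by rw [← PadicInt.maximalIdeal_eq_span_p]; exact (IsLocalRing.maximalIdeal.isMaximal ℤ_[p]).isPrime)
    D.monic.isPrimitive (by rw [← e_def]; exact D.e_pos)

/-- … hence prime in the UFD `ℤ_p[X]`. [cite: SerreLocalFields1979, Ch. I §6 Prop. 17] -/
theorem prime_poly : Prime D.poly := D.irreducible_poly.prime

/-- **`𝒪_D = ℤ_p[X]/(f)` is a domain.** [cite: SerreLocalFields1979, Ch. I §6 Prop. 17] -/
theorem isDomain_coeff : IsDomain D.Coeff := AdjoinRoot.isDomain_of_prime D.prime_poly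

/-- `ℤ_p → F` is injective. [cite: SerreLocalFields1979, Ch. II §5] -/
theorem zpToF_injective (hp : valuation F p < 1) : Function.Injective (zpToF hp : ℤ_[p] →+* F) :=
  (PadicBase.emb_injective hp).comp (PadicBase.ofPadicInt_injective hp)

/-- **`𝒪_D → F`, `X ↦ ϖ`, is injective** (its kernel is a prime of the domain `𝒪_D`, integral over `ℤ_p`, lying over `(0)`;
incomparability). [cite: SerreLocalFields1979, Ch. I §6 Prop. 18] -/
theorem Coeff.toF_injective : Function.Injective (Coeff.toF D) := by
  haveI := D.isDomain_coeff
  haveI : Module.Finite ℤ_[p] D.Coeff := (AdjoinRoot.powerBasis' D.monic).finite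
  haveI : Algebra.IsIntegral ℤ_[p] D.Coeff := Algebra.IsIntegral.of_finite _ _
  rw [RingHom.injective_iff_ker_eq_bot]
  refine Ideal.eq_bot_of_comap_eq_bot (R := ℤ_[p]) ?_
  rw [RingHom.comap_ker, AdjoinRoot.algebraMap_eq, Coeff.toF, AdjoinRoot.lift_comp_of]
  exact (RingHom.injective_iff_ker_eq_bot _).1 (zpToF_injective hp)

variable [Fact (¬ IsUnit (p : integerC F))] [IsAdicComplete (Ideal.span {(p : integerC F)}) (integerC F)]

omit [Fact (¬ IsUnit (p : integerC F))] [IsAdicComplete (Ideal.span {(p : integerC F)}) (integerC F)] in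
/-- `CoeffDisc D` (the discrete copy of `𝒪_D`) is a domain. [cite: SerreLocalFields1979, Ch. I §6 Prop. 17] -/
theorem CoeffDisc.isDomain : IsDomain (CoeffDisc D) := D.isDomain_coeff

omit [Fact (¬ IsUnit (p : integerC F))] [IsAdicComplete (Ideal.span {(p : integerC F)}) (integerC F)] in
/-- `CoeffDisc.toF : 𝒪_D → F` is injective. [cite: SerreLocalFields1979, Ch. I §6 Prop. 18] -/
theorem CoeffDisc.toF_injective : Function.Injective (CoeffDisc.toF D) := Coeff.toF_injective D

/-- `CoeffDisc.toFieldCoeff : 𝒪_D → F` is injective. [cite: SerreLocalFields1979, Ch. I §6 Prop. 18] -/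
theorem CoeffDisc.toFieldCoeff_injective (hθ : Function.Surjective (fontaineTheta (integerC F) p)) :
    Function.Injective (CoeffDisc.toFieldCoeff D hθ) := Coeff.toF_injective D

end EisensteinRoot

namespace AinfRamTop

variable [Fact (¬ IsUnit (p : integerC F))] [IsAdicComplete (Ideal.span {(p : integerC F)}) (integerC F)]
  {D : EisensteinRoot F p hp} {hθ : Function.Surjective (fontaineTheta (integerC F) p)}
  (W : WeierstrassCurve (EisensteinRoot.CoeffDisc D))

/-! ## §1 The series: `η₀` over `F`, and an integral multiplication defect `R_n ∈ 𝒪_D⟦X⟧` -/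

variable (hθ) in
/-- **The quasi-period function `η₀ ∈ F⟦X⟧` of `W ×_{𝒪_D} F`** over the discrete coefficient field `FieldCoeff hp hθ`.
[cite: Katz1981CrystallineDieudonne, §5.1] -/
def etaSeries : PowerSeries (FieldCoeff hp hθ) := (W.map (EisensteinRoot.CoeffDisc.toFieldCoeff D hθ)).formalQuasiPeriod

/-- `η₀(0) = 0`. [cite: Katz1981CrystallineDieudonne, §5.1] -/
theorem constantCoeff_etaSeries : PowerSeries.constantCoeff (etaSeries hθ W) = 0 :=
  WeierstrassCurve.constantCoeff_formalQuasiPeriod _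

/-- **An integral multiplication defect `R_n ∈ 𝒪_D⟦X⟧`** with `R_n ↦ Σ_{k<n} C₀([k]X, X)` in `F⟦X⟧`
(`exists_map_eq_formalQuasiPeriodMulDefect` along `𝒪_D ↪ F`). [cite: Katz1981CrystallineDieudonne, §5.1] -/
def mulDefect (n : ℕ) : PowerSeries (EisensteinRoot.CoeffDisc D) :=
  haveI := EisensteinRoot.CoeffDisc.isDomain D
  Classical.choose (W.exists_map_eq_formalQuasiPeriodMulDefect (φ := EisensteinRoot.CoeffDisc.toFieldCoeff D hθ)
    (EisensteinRoot.CoeffDisc.toFieldCoeff_injective D hθ) n)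

/-- `R_n ⊗ F = Σ_{k<n} C₀([k]X, X)`. [cite: Katz1981CrystallineDieudonne, §5.1] -/
theorem map_mulDefect (n : ℕ) :
    PowerSeries.map (EisensteinRoot.CoeffDisc.toFieldCoeff D hθ) (mulDefect (hθ := hθ) W n) =
      (W.map (EisensteinRoot.CoeffDisc.toFieldCoeff D hθ)).formalQuasiPeriodMulDefect n :=
  haveI := EisensteinRoot.CoeffDisc.isDomain D
  Classical.choose_spec (W.exists_map_eq_formalQuasiPeriodMulDefect (φ := EisensteinRoot.CoeffDisc.toFieldCoeff D hθ)
    (EisensteinRoot.CoeffDisc.toFieldCoeff_injective D hθ) n)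

/-- `R_n(0) = 0` (each `C₀([k]X, X)` has no constant term). [cite: Katz1981CrystallineDieudonne, §5.1] -/
theorem constantCoeff_mulDefect (n : ℕ) : PowerSeries.constantCoeff (mulDefect (hθ := hθ) W n) = 0 := by
  apply EisensteinRoot.CoeffDisc.toFieldCoeff_injective D hθ
  set V := W.map (EisensteinRoot.CoeffDisc.toFieldCoeff D hθ) with hV
  have h := congrArg PowerSeries.constantCoeff (map_mulDefect (hθ := hθ) W n)
  rw [← PowerSeries.coeff_zero_eq_constantCoeff_apply, PowerSeries.coeff_map, PowerSeries.coeff_zero_eq_constantCoeff_apply] at h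
  rw [map_zero, h, WeierstrassCurve.formalQuasiPeriodMulDefect, map_sum]
  refine Finset.sum_eq_zero fun k _ => ?_
  exact MvPowerSeries.constantCoeff_subst_eq_zero
    (Literature.NumberTheory.EllipticCurves.hasSubst_pair_X (V.constantCoeff_formalMul k))
    (fun i => by fin_cases i; exacts [V.constantCoeff_formalMul k, PowerSeries.constantCoeff_X]) V.constantCoeff_formalQuasiPeriodCocycle

/-! ## §2 The main term `η₀(ι_𝒪T₀)` -/

/-- **The main term `η₀(ι_𝒪[t]) ∈ B_dR⁺(F)`** of the η-period: the quasi-period function evaluated `ξ`-adically at the image of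
Fontaine's element in `Fil¹`. [cite: Colmez1992PeriodesAbeliennes, §2] -/
def etaPeriodMain (hθ : Function.Surjective (fontaineTheta (integerC F) p)) (t : ℕ → (maxNilIdealC F).toIdeal)
    (ht0 : (t 0 : CBall F) = 0) (htp : ∀ n, mulPC W (t (n + 1)) = t n) : BdRPlusTop F p :=
  (evalPt₁ (BdRPlusTop.filOne F p) (etaSeries hθ W) (constantCoeff_etaSeries W) (torsionLiftFil W hθ t ht0 htp) : BdRPlusTop F p)

/-- **`σ(η₀(ι_𝒪[t])) = η₀(ι_𝒪[σt])`.** [cite: FontaineAsterisque223III, Exp. II §1.5.4] -/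
theorem gal_etaPeriodMain (σ : absoluteGaloisGroup F) {t : ℕ → (maxNilIdealC F).toIdeal} (ht0 : (t 0 : CBall F) = 0)
    (htp : ∀ n, mulPC W (t (n + 1)) = t n) :
    BdRPlusTop.gal F p σ (etaPeriodMain W hθ t ht0 htp) =
      etaPeriodMain W hθ (AinfTop.galSeq F σ t) (AinfTop.coe_galSeq_zero σ ht0) (mulPC_galSeq W hθ σ htp) := by
  rw [etaPeriodMain, etaPeriodMain, FieldCoeff.gal_evalPt₁]
  congr 2
  exact Subtype.ext (gal_torsionLiftFil W σ ht0 htp)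

/-! ## §3 The shifted sequences and their Fontaine elements `Tᵢ = [t⁽ⁱ⁾]` -/

omit [Fact (¬ IsUnit (p : integerC F))] [IsAdicComplete (Ideal.span {(p : integerC F)}) (integerC F)] in
/-- The shifted sequence `t⁽ⁱ⁾ = (u_{n+i})ₙ` (`AinfTop.shiftSeq`) is `[p]_W`-compatible. [cite: FontaineAsterisque223III, Exp. II §1.2.2] -/
theorem shiftSeq_compat {t : ℕ → (maxNilIdealC F).toIdeal} (htp : ∀ n, mulPC W (t (n + 1)) = t n) (i : ℕ) :
    ∀ n, mulPC W (AinfTop.shiftSeq F t i (n + 1)) = AinfTop.shiftSeq F t i n := fun n => by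
  simp only [AinfTop.shiftSeq, Nat.add_right_comm n 1 i]
  exact htp (n + i)

/-- **`Tᵢ = [t⁽ⁱ⁾] ∈ A_inf(𝒪)`**, Fontaine's element of the shifted sequence. [cite: FontaineAsterisque223III, Exp. II §1.2.2] -/
def torsionLiftShift (hθ : Function.Surjective (fontaineTheta (integerC F) p)) (t : ℕ → (maxNilIdealC F).toIdeal)
    (htp : ∀ n, mulPC W (t (n + 1)) = t n) (i : ℕ) : AinfRamTop D :=
  torsionLift W hθ (AinfTop.shiftSeq F t i) (shiftSeq_compat W htp i)

/-- `θ_𝒪` of a Fontaine limit all of whose approximants have the same `θ_𝒪`-value `c` is `c` (continuity of `θ_𝒪`).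
[cite: FontaineAsterisque223III, Exp. II §1.2.2] -/
theorem theta_flim_eq_of_forall {φ : (nilTheta D hθ).toIdeal → (nilTheta D hθ).toIdeal} (hφ : IsContracting hθ φ)
    {u : ℕ → (nilTheta D hθ).toIdeal}
    (hu : ∀ n, ((φ (u (n + 1)) : (nilTheta D hθ).toIdeal) : AinfRamTop D) - u n ∈ (WithIdeal.i : Ideal (AinfRamTop D)))
    {c : CBall F} (hc : ∀ n, theta D (approx φ u n) = c) : theta D (flim hφ u hu) = c := by
  have h1 : Tendsto (fun n => theta D (approx φ u n)) atTop (𝓝 (theta D (flim hφ u hu))) :=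
    ((continuous_theta (D := D)).tendsto (flim hφ u hu)).comp (tendsto_approx_flim hφ hu)
  have h2 : (fun n => theta D (approx φ u n)) = fun _ => c := funext hc
  rw [h2] at h1
  exact (tendsto_nhds_unique tendsto_const_nhds h1).symm

/-- **`θ_𝒪(Tᵢ) = uᵢ`** (`θ_𝒪([pⁿ]û_{n+i}) = [pⁿ]u_{n+i} = uᵢ` for all `n`). [cite: FontaineAsterisque223III, Exp. II §1.2.2] -/
theorem theta_torsionLiftShift {t : ℕ → (maxNilIdealC F).toIdeal} (htp : ∀ n, mulPC W (t (n + 1)) = t n) (i : ℕ) :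
    theta D (torsionLiftShift W hθ t htp i) = t i := by
  rw [torsionLiftShift, torsionLift]
  refine theta_flim_eq_of_forall _ _ fun n => ?_
  rw [approx_def, theta_mulP_iterate]
  have h : (⟨theta D (lift D hθ (AinfTop.shiftSeq F t i) n : AinfRamTop D), theta_mem_maxNilIdealC (lift D hθ (AinfTop.shiftSeq F t i) n).2⟩ :
      (maxNilIdealC F).toIdeal) = AinfTop.shiftSeq F t i (0 + n) :=
    Subtype.ext (by rw [zero_add]; exact theta_lift (AinfTop.shiftSeq F t i) n)
  rw [h, mulPC_iterate_eq W (shiftSeq_compat W htp i) 0 n]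
  show ((t (0 + i) : (maxNilIdealC F).toIdeal) : CBall F) = t i
  rw [Nat.zero_add]

/-- `Tᵢ ∈ 𝔫 = θ_𝒪⁻¹(𝔪_{ℂ_F})`. [cite: FontaineAsterisque223III, Exp. II §1.2.2] -/
theorem torsionLiftShift_mem_nilTheta {t : ℕ → (maxNilIdealC F).toIdeal} (htp : ∀ n, mulPC W (t (n + 1)) = t n) (i : ℕ) :
    torsionLiftShift W hθ t htp i ∈ (nilTheta D hθ).toIdeal := by
  rw [mem_nilTheta_iff, theta_torsionLiftShift]
  exact (t i).2

/-- `Tᵢ` as a point of `𝔫`. [cite: FontaineAsterisque223III, Exp. II §1.2.2] -/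
def torsionLiftShiftPt (hθ : Function.Surjective (fontaineTheta (integerC F) p)) (t : ℕ → (maxNilIdealC F).toIdeal)
    (htp : ∀ n, mulPC W (t (n + 1)) = t n) (i : ℕ) : (nilTheta D hθ).toIdeal :=
  ⟨torsionLiftShift W hθ t htp i, torsionLiftShift_mem_nilTheta W htp i⟩

/-- Unfolding. [cite: FontaineAsterisque223III, Exp. II §1.2.2] -/
@[simp] theorem coe_torsionLiftShiftPt {t : ℕ → (maxNilIdealC F).toIdeal} (htp : ∀ n, mulPC W (t (n + 1)) = t n) (i : ℕ) :
    ((torsionLiftShiftPt W hθ t htp i : (nilTheta D hθ).toIdeal) : AinfRamTop D) = torsionLiftShift W hθ t htp i := rfl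

/-- `T₀ = [t]`. [cite: FontaineAsterisque223III, Exp. II §1.2.2] -/
theorem torsionLiftShift_zero {t : ℕ → (maxNilIdealC F).toIdeal} (htp : ∀ n, mulPC W (t (n + 1)) = t n) :
    torsionLiftShift W hθ t htp 0 = torsionLift W hθ t htp := rfl

/-- **`[p]T_{i+1} = Tᵢ`**: `[p]` maps Fontaine's element of `t⁽ⁱ⁺¹⁾` to that of `t⁽ⁱ⁾` (contraction of `[p]` and independence of
the lifts). [cite: FontaineAsterisque223III, Exp. II §1.2.2] -/
theorem mulP_torsionLiftShiftPt {t : ℕ → (maxNilIdealC F).toIdeal} (htp : ∀ n, mulPC W (t (n + 1)) = t n) (i : ℕ) :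
    (mulP W (torsionLiftShiftPt W hθ t htp (i + 1)) : AinfRamTop D) = torsionLiftShift W hθ t htp i := by
  -- lifts `vₙ` of `u_{n+i+1}`; `u'ₙ := [p]vₙ` lifts `u_{n+i}`
  set v := lift D hθ (AinfTop.shiftSeq F t (i + 1)) with hv
  have hvθ : ∀ n, theta D (v n : AinfRamTop D) = AinfTop.shiftSeq F t (i + 1) n := theta_lift _
  have hv' : ∀ n, ((mulP W (v (n + 1)) : (nilTheta D hθ).toIdeal) : AinfRamTop D) - v n ∈ (WithIdeal.i : Ideal (AinfRamTop D)) :=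
    mulP_lift_sub_mem W (shiftSeq_compat W htp (i + 1)) hvθ
  set u' : ℕ → (nilTheta D hθ).toIdeal := fun n => mulP W (v n) with hu'
  have hu'θ : ∀ n, theta D (u' n : AinfRamTop D) = AinfTop.shiftSeq F t i n := fun n => by
    show theta D (mulP W (v n) : AinfRamTop D) = t (n + i)
    rw [theta_mulP, ← htp (n + i)]
    congr 2
    exact Subtype.ext (by
      show theta D (v n : AinfRamTop D) = ((t (n + i + 1) : (maxNilIdealC F).toIdeal) : CBall F)
      rw [hvθ n]; rfl)
  have hu'' : ∀ n, ((mulP W (u' (n + 1)) : (nilTheta D hθ).toIdeal) : AinfRamTop D) - u' n ∈ (WithIdeal.i : Ideal (AinfRamTop D)) :=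
    mulP_lift_sub_mem W (shiftSeq_compat W htp i) hu'θ
  -- `Tᵢ = flim u'` by independence of the lifts
  rw [torsionLiftShift, torsionLift_eq_flim W (shiftSeq_compat W htp i) hu'θ]
  -- `[p]T_{i+1}` satisfies the characterisation of `flim u'`
  refine eq_flim_of_forall_sub_mem (isContracting_mulP (hθ := hθ) W) hu'' fun n => ?_
  have h1 : (torsionLiftShift W hθ t htp (i + 1)) - approx (mulP W) v n ∈ (WithIdeal.i ^ (n + 1) : Ideal (AinfRamTop D)) :=
    flim_sub_approx_mem (isContracting_mulP (hθ := hθ) W) hv' n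
  have h2 := isContracting_mulP (hθ := hθ) W n (torsionLiftShiftPt W hθ t htp (i + 1))
    ((mulP W)^[n] (v n)) h1
  have h3 : approx (mulP W) u' n = ((mulP W ((mulP W)^[n] (v n)) : (nilTheta D hθ).toIdeal) : AinfRamTop D) := by
    rw [approx_def, show u' n = mulP W (v n) from rfl, ← Function.iterate_succ_apply, Function.iterate_succ_apply']
  rw [h3]
  exact Ideal.pow_le_pow_right (Nat.le_succ _) h2

/-- **`σ(Tᵢ) = Tᵢ(σt)`.** [cite: FontaineAsterisque223III, Exp. II §1.2] -/
theorem gal_torsionLiftShift (σ : absoluteGaloisGroup F) {t : ℕ → (maxNilIdealC F).toIdeal}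
    (htp : ∀ n, mulPC W (t (n + 1)) = t n) (i : ℕ) :
    gal D σ (torsionLiftShift W hθ t htp i) =
      torsionLiftShift W hθ (AinfTop.galSeq F σ t) (mulPC_galSeq W hθ σ htp) i := by
  rw [torsionLiftShift, gal_torsionLift W σ]
  rfl

/-! ## §4 The correction `Σ_{i≥1} p^{i−1} R_p(Tᵢ) ∈ A_inf(𝒪)` -/

/-- `R_p(Tᵢ) ∈ A_inf(𝒪)` (integral series at a point of `𝔫`). [cite: Colmez1992PeriodesAbeliennes, §2] -/
def mulDefectAt (hθ : Function.Surjective (fontaineTheta (integerC F) p)) (t : ℕ → (maxNilIdealC F).toIdeal)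
    (htp : ∀ n, mulPC W (t (n + 1)) = t n) (i : ℕ) : AinfRamTop D :=
  (evalPt₁ (nilTheta D hθ) (mulDefect (hθ := hθ) W p) (constantCoeff_mulDefect W p) (torsionLiftShiftPt W hθ t htp i) : AinfRamTop D)

/-- The partial sums `Sₙ = Σ_{i<n} pⁱ R_p(T_{i+1})`. [cite: Colmez1992PeriodesAbeliennes, §2] -/
def etaCorrPartial (hθ : Function.Surjective (fontaineTheta (integerC F) p)) (t : ℕ → (maxNilIdealC F).toIdeal)
    (htp : ∀ n, mulPC W (t (n + 1)) = t n) (n : ℕ) : AinfRamTop D :=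
  ∑ i ∈ Finset.range n, (p : AinfRamTop D) ^ i * mulDefectAt W hθ t htp (i + 1)

/-- `S_{n+2} − S_{n+1} = p^{n+1}R_p(T_{n+2}) ∈ 𝔦^{n+1}`. [cite: Colmez1992PeriodesAbeliennes, §2] -/
theorem etaCorrPartial_succ_sub_mem {t : ℕ → (maxNilIdealC F).toIdeal} (htp : ∀ n, mulPC W (t (n + 1)) = t n) (n : ℕ) :
    etaCorrPartial W hθ t htp (n + 1 + 1) - etaCorrPartial W hθ t htp (n + 1) ∈ (WithIdeal.i ^ (n + 1) : Ideal (AinfRamTop D)) := by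
  rw [etaCorrPartial, Finset.sum_range_succ, ← etaCorrPartial, add_sub_cancel_left]
  exact Ideal.mul_mem_right _ _ (Ideal.pow_mem_pow (natCast_mem_ideal D) _)

/-- **The correction `Σ_{i≥1} p^{i−1} R_p(Tᵢ) ∈ A_inf(𝒪)`**: the `(p, ω)`-adic limit of the partial sums (existence by completeness).
[cite: Colmez1992PeriodesAbeliennes, §2] -/
def etaCorr (hθ : Function.Surjective (fontaineTheta (integerC F) p)) (t : ℕ → (maxNilIdealC F).toIdeal)
    (htp : ∀ n, mulPC W (t (n + 1)) = t n) : AinfRamTop D :=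
  Classical.choose (exists_lim_of_forall_sub_mem_pow_succ (f := fun n => etaCorrPartial W hθ t htp (n + 1))
    (etaCorrPartial_succ_sub_mem W htp))

/-- `etaCorr − S_{n+1} ∈ 𝔦^{n+1}`. [cite: Colmez1992PeriodesAbeliennes, §2] -/
theorem etaCorr_sub_partial_mem {t : ℕ → (maxNilIdealC F).toIdeal} (htp : ∀ n, mulPC W (t (n + 1)) = t n) (n : ℕ) :
    etaCorr W hθ t htp - etaCorrPartial W hθ t htp (n + 1) ∈ (WithIdeal.i ^ (n + 1) : Ideal (AinfRamTop D)) :=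
  Classical.choose_spec (exists_lim_of_forall_sub_mem_pow_succ (f := fun n => etaCorrPartial W hθ t htp (n + 1))
    (etaCorrPartial_succ_sub_mem W htp)) n

/-- The partial sums tend to `etaCorr`. [cite: Colmez1992PeriodesAbeliennes, §2] -/
theorem tendsto_etaCorrPartial {t : ℕ → (maxNilIdealC F).toIdeal} (htp : ∀ n, mulPC W (t (n + 1)) = t n) :
    Tendsto (fun n => etaCorrPartial W hθ t htp (n + 1)) atTop (𝓝 (etaCorr W hθ t htp)) :=
  tendsto_of_forall_sub_mem_pow (etaCorr_sub_partial_mem W htp)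

/-- `σ(R_p(Tᵢ)) = R_p(Tᵢ(σt))`. [cite: FontaineAsterisque223III, Exp. II §1.2] -/
theorem gal_mulDefectAt (σ : absoluteGaloisGroup F) {t : ℕ → (maxNilIdealC F).toIdeal}
    (htp : ∀ n, mulPC W (t (n + 1)) = t n) (i : ℕ) :
    gal D σ (mulDefectAt W hθ t htp i) = mulDefectAt W hθ (AinfTop.galSeq F σ t) (mulPC_galSeq W hθ σ htp) i := by
  rw [mulDefectAt, mulDefectAt, evalPt₁, evalPt₁]
  exact gal_evalPt σ (EisensteinRoot.gal_algebraMap_coeffDisc D σ) _ _ (fun _ : Unit => torsionLiftShiftPt W hθ t htp i)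
    (fun _ : Unit => torsionLiftShiftPt W hθ (AinfTop.galSeq F σ t) (mulPC_galSeq W hθ σ htp) i)
    fun _ => gal_torsionLiftShift W σ htp i

/-- `σ(Sₙ) = Sₙ(σt)`. [cite: FontaineAsterisque223III, Exp. II §1.2] -/
theorem gal_etaCorrPartial (σ : absoluteGaloisGroup F) {t : ℕ → (maxNilIdealC F).toIdeal}
    (htp : ∀ n, mulPC W (t (n + 1)) = t n) (n : ℕ) :
    gal D σ (etaCorrPartial W hθ t htp n) = etaCorrPartial W hθ (AinfTop.galSeq F σ t) (mulPC_galSeq W hθ σ htp) n := by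
  simp only [etaCorrPartial, map_sum, map_mul, map_pow, map_natCast, gal_mulDefectAt]

/-- **`σ(Σ p^{i−1}R_p(Tᵢ)) = Σ p^{i−1}R_p(Tᵢ(σt))`** (continuity of `σ`, uniqueness of limits). [cite: FontaineAsterisque223III, Exp. II §1.2] -/
theorem gal_etaCorr (σ : absoluteGaloisGroup F) {t : ℕ → (maxNilIdealC F).toIdeal}
    (htp : ∀ n, mulPC W (t (n + 1)) = t n) :
    gal D σ (etaCorr W hθ t htp) = etaCorr W hθ (AinfTop.galSeq F σ t) (mulPC_galSeq W hθ σ htp) := by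
  have h1 : Tendsto (fun n => gal D σ (etaCorrPartial W hθ t htp (n + 1))) atTop (𝓝 (gal D σ (etaCorr W hθ t htp))) :=
    ((continuous_gal σ).tendsto _).comp (tendsto_etaCorrPartial W htp)
  simp only [gal_etaCorrPartial] at h1
  exact tendsto_nhds_unique h1 (tendsto_etaCorrPartial W (mulPC_galSeq W hθ σ htp))

/-! ## §5 The η-period -/

/-- **The η-period `∫_t η := η₀(ι_𝒪[t]) − ι_𝒪(Σ_{i≥1} p^{i−1} R_p([t⁽ⁱ⁾])) ∈ B_dR⁺(F)`** of a `p`-power-compatible sequence of torsion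
points of `Ŵ(𝒪_{ℂ_F})`, `W` over `𝒪_D` — Colmez's `lim pⁿη₀(ûₙ)` in closed form (`ι_𝒪 : A_inf(𝒪) → B_dR⁺`).
[cite: Colmez1992PeriodesAbeliennes, §2] -/
def etaPeriod (hθ : Function.Surjective (fontaineTheta (integerC F) p)) (t : ℕ → (maxNilIdealC F).toIdeal)
    (ht0 : (t 0 : CBall F) = 0) (htp : ∀ n, mulPC W (t (n + 1)) = t n) : BdRPlusTop F p :=
  etaPeriodMain W hθ t ht0 htp - BdRPlusTop.of F p (AinfRam.toBdR D hθ ((of D).symm (etaCorr W hθ t htp)))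

/-- **`Γ_F`-equivariance of the η-period: `σ(∫_t η) = ∫_{σt} η`.** [cite: Colmez1992PeriodesAbeliennes, §2]
[cite: FontaineAsterisque223III, Exp. II §1.5.4] -/
theorem gal_etaPeriod (σ : absoluteGaloisGroup F) {t : ℕ → (maxNilIdealC F).toIdeal} (ht0 : (t 0 : CBall F) = 0)
    (htp : ∀ n, mulPC W (t (n + 1)) = t n) :
    BdRPlusTop.gal F p σ (etaPeriod W hθ t ht0 htp) =
      etaPeriod W hθ (AinfTop.galSeq F σ t) (AinfTop.coe_galSeq_zero σ ht0) (mulPC_galSeq W hθ σ htp) := by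
  rw [etaPeriod, etaPeriod, map_sub, gal_etaPeriodMain, BdRPlusTop.gal_of, AinfRam.galBdRPlus_toBdR, ← gal_etaCorr W σ htp]
  rfl

end AinfRamTop

end Literature.NumberTheory.PAdicHodge

end
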